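import Summits.CriticalPhenomena.Ising3DConformalLimit.Theorems.LogPolarProxyExistsContinuousLimitDoublingSplit
import Summits.CriticalPhenomena.Ising3DConformalLimit.Theorems.HyperoctahedralRPExistsScaleCovariantLimitFoldedCurrentIdentity
import Summits.CriticalPhenomena.Ising3DConformalLimit.Theorems.ReflectionTwinExistsContinuousLimitFoldUnion
import Summits.CriticalPhenomena.Ising3DConformalLimit.Theorems.ReflectionTwinExistsContinuousLimitConfinement
import Summits.CriticalPhenomena.Ising3DConformalLimit.Theorems.ReflectionTwinExistsContinuousLimitSupermodular
import Summits.CriticalPhenomena.Ising3DConformalLimit.Theorems.ReflectionTwinExistsContinuousLimitFaceBound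
import Summits.CriticalPhenomena.Ising3DConformalLimit.Theorems.ReflectionTwinExistsContinuousLimitMmsFaces
import Summits.CriticalPhenomena.Ising3DConformalLimit.Theorems.ReflectionTwinExistsContinuousLimitTorusMaster
import Summits.CriticalPhenomena.Ising3DConformalLimit.Theorems.ReflectionTwinExistsContinuousLimitFoldChain
import Summits.CriticalPhenomena.Ising3DConformalLimit.Theorems.ReflectionTwinExistsContinuousLimitCubeChain
import Literature.Probability.LatticeModels.TorusFoldable
import Literature.Probability.LatticeModels.TorusTwoPointLimit
import Literature.Probability.LatticeModels.CriticalTwoPointDCPLowerTorus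
import Literature.Probability.LatticeModels.CriticalTwoPointBounds
import Literature.Probability.LatticeModels.CriticalTwoPointLower
import Literature.Probability.LatticeModels.MessagerMiracleSole
import HarnessLib

/-!
# Skeleton — crux `ExistsContinuousLimit` (stmt-CriticalPhenomena-4582), line `free-box-deficit`

Lead c5 (`prover-line-stmt-CriticalPhenomena-4582-c5-0`). The served skeleton
(`run/gate/evidence/stmt-CriticalPhenomena-4582/20260817T101314Z-Sketch.lean`, crux-ideate r1 ideator 2,
idea `Cruxes/ExistsContinuousLimit/Ideas/free-box-deficit.md`) reshaped into registered stubs.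

THE LINE. The crux (the open existence problem of the critical `ℤ³` Ising scaling limit) IS
item 6150 `TwoPointDoubling` ∧ item 4659 `ClusterSetTotallyDisconnected` (landed split p149785). This line attacks
the lattice child 6150 through the **fold chain**: two symmetric Aizenman/Duminil-Copin–Panis folds, the
single-current CONFINEMENT inequality `⟨σₓσ_y⟩_Λ · P^{xy}_Λ[C_n(y) ⊆ T] ≤ ⟨σₓσ_y⟩^free_T` and Messager–Miracle-Solé
give, for the free-boundary boxes of aspect ratio one around the axis pair `(0, ne₀)` and the diagonal pair
`(0, (n,n,0))`,
`g(n) − freeA(n) ≤ 6·Gd(n)` and `Gd(n) − freeD(n) ≤ 6·g(2n)` (`g(n) = G(ne₀)`, `Gd(n) = G(n,n,0)`,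
`G = criticalTwoPoint 3`), so the two FREE-BOX DEFICITS `freeA ≤ (1−c₁) g`, `freeD ≤ (1−c₂) Gd` (open,
numerically ≈ 80 %, kit j025008) give doubling with `κ = c₁c₂/36`.

RESHAPING w.r.t. the served sketch: (i) the engine runs on the EVEN TORI `(ℤ/Lℤ)³` (all six face reflections of a
box are simultaneously fold data there — `Torus.isFoldable_leftSites/rightSites`; no finite `Λ ⊂ ℤ³` is symmetric
under two parallel mirrors) and passes to `L → ∞` with `TorusTwoPointLimit` (`m*(β_c) = 0`, proved in tree);
(ii) the 45° box around the diagonal pair is replaced by the ANISOTROPIC COORDINATE box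
`(−h, n+h) × (−h, n+h) × (−n, n)`, `h = ⌈n/2⌉`: its six coordinate mirrors send `(n,n,0)` to points of sup-norm
`≥ 2n`, so MMS alone bounds every face ratio by `g(2n)/Gd(n)` — no diagonal fold datum is needed.

RESHAPE c7 (lead `prover-line-stmt-CriticalPhenomena-4582-c7-0`, 2026-08-17): the two open deficits of c5/c6
(`stub_axisBoxDeficit` on `A_n = (−h,n+h)×(−h,h)²`, `stub_diagBoxDeficit` on `D_n = (−h,n+h)²×(−n,n)`) are replaced by ONE
open stub `stub_cubeDeficit` on the FAT axis box `C_n = (−h, n+h) × (−n, n)²` (a lattice cube of side `≈ 2n`): all six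
face mirrors of `C_n` send `ne₀` to sup-norm `≥ 2n`, so `faceBound` + MMS give the CUBE FOLD CHAIN
`g(n) − freeC(n) ≤ 6·g(2n)` directly (`cubeFoldChain'`, file `Theorems/ReflectionTwinExistsContinuousLimitCubeChain.lean`),
and `freeC ≤ (1−c)·g` alone gives doubling with `κ = c/6` — no diagonal box, no `G(n,n,0)` step. Sorries 2 → 1.

Stubs (registered; sorries ONLY here): `stub_supermodular` (GKS supermodularity of sourceless current sums in the
support), `stub_confinement` (cluster decomposition + supermodularity ⟹ confinement), `stub_foldUnion` (exit through a
face ⟹ folded connection; union bound + fold identity, abstract fold data), `stub_torusMaster` (assembly on the even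
torus for lattice coordinate boxes), `stub_faceBound` (torus → `ℤ³` limit at `β_c`), `stub_mmsFaces` (MMS bounds of
the twelve reflected points), `stub_boxDeficits` (the two free-box deficits — OPEN, research). Glue (proved):
`axisFoldChain_of`, `diagFoldChain_of`, `twoPointDoubling_of`, `ExistsContinuousLimit_of` (item 4659 by name).
-/

noncomputable section

namespace Summit.CriticalPhenomena.Ising3DConformalLimit.ReflectionTwinExistsContinuousLimit.FreeBox

open Finset Filter
open scoped BigOperators symmDiff ENNReal Topology
open Literature.Probability.LatticeModels
open Summit.CriticalPhenomena.Ising3DConformalLimit.Theses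
open Summit.CriticalPhenomena.Ising3DConformalLimit.LogPolarProxyExistsContinuousLimit
  (reflectionTwin_existsContinuousLimit_of_doubling_of_totallyDisconnected)
open Summit.CriticalPhenomena.Ising3DConformalLimit.Cruxes.ExistsScaleCovariantLimit.FoldedCurrentRepulsion
  (currentZ_singleton_symmDiff_reflect_eq)
open Classical

/-! ## §0 Vocabulary (local abbreviations; every stub signature below is fully expanded) -/

/-- Half-margin `h(n) = ⌈n/2⌉ = (n+1)/2` of the free boxes (`2h ≥ n`, `h ≥ 1` for `n ≥ 1`). [folklore] -/
def hm (n : ℕ) : ℕ := (n + 1) / 2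

/-- Lower corner of the axis box `(−h, n+h) × (−h, h) × (−h, h)` (open box; sites `1−h … `). [folklore] -/
def axisLo (n : ℕ) : Site 3 := fun _ => 1 - (hm n : ℤ)

/-- Upper corner of the axis box. [folklore] -/
def axisHi (n : ℕ) : Site 3 := fun i => if i = 0 then (n : ℤ) + (hm n : ℤ) - 1 else (hm n : ℤ) - 1

/-- Lower corner of the (anisotropic coordinate) diagonal box `(−h, n+h)² × (−n, n)`. [folklore] -/
def diagLo (n : ℕ) : Site 3 := fun i => if i = 2 then 1 - (n : ℤ) else 1 - (hm n : ℤ)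

/-- Upper corner of the diagonal box. [folklore] -/
def diagHi (n : ℕ) : Site 3 := fun i => if i = 2 then (n : ℤ) - 1 else (n : ℤ) + (hm n : ℤ) - 1

/-- Lower corner of the fat axis box (cube) `(−h, n+h) × (−n, n)²` (c7). [folklore] -/
def cubeLo (n : ℕ) : Site 3 := fun i => if i = 0 then 1 - (hm n : ℤ) else 1 - (n : ℤ)

/-- Upper corner of the fat axis box (cube). [folklore] -/
def cubeHi (n : ℕ) : Site 3 := fun i => if i = 0 then (n : ℤ) + (hm n : ℤ) - 1 else (n : ℤ) - 1

/-- The coordinate box with corners `l ≤ u`. [folklore] -/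
def cbox (l u : Site 3) : Finset (Site 3) := Fintype.piFinset fun i => Finset.Icc (l i) (u i)

/-- The axis pair's far point `n e₀`. [folklore] -/
def axisPt (n : ℕ) : Site 3 := Pi.single 0 (n : ℤ)

/-- The diagonal pair's far point `(n, n, 0)`. [folklore] -/
def diagPt (n : ℕ) : Site 3 := Pi.single 0 (n : ℤ) + Pi.single 1 (n : ℤ)

/-- `freeA n = ⟨σ₀ σ_{ne₀}⟩^free_{axis box}` at `β_c`. [folklore] -/
def freeA (n : ℕ) : ℝ := isingTwoPoint (zdGraph 3) (cbox (axisLo n) (axisHi n)) (criticalBeta 3) 0 .free 0 (axisPt n)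

/-- `freeD n = ⟨σ₀ σ_{(n,n,0)}⟩^free_{diagonal box}` at `β_c`. [folklore] -/
def freeD (n : ℕ) : ℝ := isingTwoPoint (zdGraph 3) (cbox (diagLo n) (diagHi n)) (criticalBeta 3) 0 .free 0 (diagPt n)

/-- `freeC n = ⟨σ₀ σ_{ne₀}⟩^free_{cube}` at `β_c` (c7). [folklore] -/
def freeC (n : ℕ) : ℝ := isingTwoPoint (zdGraph 3) (cbox (cubeLo n) (cubeHi n)) (criticalBeta 3) 0 .free 0 (axisPt n)

/-- The sum of the bulk two-point function over the six reflected images of `y` in the faces of the box `[l,u]`,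
seen from `x`. [folklore] -/
def faceSum (l u x y : Site 3) : ℝ :=
  ∑ i : Fin 3, (criticalTwoPoint 3 (Function.update y i (2 * (u i + 1) - y i) - x) +
    criticalTwoPoint 3 (Function.update y i (2 * (l i - 1) - y i) - x))

/-! ## §1 Statements carried between stubs (plain `Prop`s, expanded verbatim in the stub signatures) -/

/-- CONFINEMENT on the torus `(ℤ/Lℤ)³`: `Z^{xy}_𝕋[C_n(y) ⊆ T] · Z^∅_T ≤ Z^{xy}_T · Z^∅_𝕋`. [folklore] -/
def TorusConfinement : Prop :=
  ∀ (L : ℕ) [NeZero L] (β : ℝ), 0 ≤ β → ∀ (T : Finset (TorusSite 3 L)) (x y : TorusSite 3 L), x ∈ T → y ∈ T →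
    (∑' n : edgesIn (torusGraph 3 L) univ → ℕ,
        ind (csources (torusGraph 3 L) univ n = {x} ∆ {y} ∧ CSupp (torusGraph 3 L) univ (edgesIn (torusGraph 3 L) univ) n ∧
              ∀ v, CConn (torusGraph 3 L) univ n (edgesIn (torusGraph 3 L) univ) y v → v ∈ T) *
          cweight (torusGraph 3 L) univ β n) *
      currentZ (torusGraph 3 L) univ β (edgesIn (torusGraph 3 L) T) ∅ ≤
    currentZ (torusGraph 3 L) univ β (edgesIn (torusGraph 3 L) T) ({x} ∆ {y}) *
      currentZ (torusGraph 3 L) univ β (edgesIn (torusGraph 3 L) univ) ∅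

/-- FOLD-UNION on the torus: with six fold data whose strict halves contain `T` and whose mirrors catch every exit
edge of `T`, `Z^{xy} ≤ Z^{xy}[C_n(y) ⊆ T] + ∑_F Z^{x, θ_F y}`. [folklore] -/
def TorusFoldUnion : Prop :=
  ∀ (L : ℕ) [NeZero L] (β : ℝ), 0 ≤ β →
    ∀ (θ : Fin 3 × Bool → TorusSite 3 L ≃ TorusSite 3 L) (H : Fin 3 × Bool → Finset (TorusSite 3 L)),
      (∀ j, IsFoldable (torusGraph 3 L) (θ j) univ (H j)) →
    ∀ (T : Finset (TorusSite 3 L)), (∀ j, T ⊆ H j) →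
      (∀ v w, v ∈ T → w ∉ T → (torusGraph 3 L).Adj v w → ∃ j, θ j w = w) →
    ∀ (x y : TorusSite 3 L), x ∈ T → y ∈ T →
      currentZ (torusGraph 3 L) univ β (edgesIn (torusGraph 3 L) univ) ({x} ∆ {y}) ≤
        (∑' n : edgesIn (torusGraph 3 L) univ → ℕ,
          ind (csources (torusGraph 3 L) univ n = {x} ∆ {y} ∧ CSupp (torusGraph 3 L) univ (edgesIn (torusGraph 3 L) univ) n ∧
                ∀ v, CConn (torusGraph 3 L) univ n (edgesIn (torusGraph 3 L) univ) y v → v ∈ T) *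
            cweight (torusGraph 3 L) univ β n) +
        ∑ j, currentZ (torusGraph 3 L) univ β (edgesIn (torusGraph 3 L) univ) ({x} ∆ {θ j y})

/-- TORUS MASTER INEQUALITY for lattice coordinate boxes: for `β ≥ 0`, `L` even, `4M + 2 ≤ L`, a box `[l,u] ⊆ Λ_{M−1}`
and `x, y` in it, `⟨σ_x̄σ_ȳ⟩_𝕋 ≤ ⟨σₓσ_y⟩^free_{[l,u]} + ∑_{faces} ⟨σ_x̄ σ_{θ_F ȳ}⟩_𝕋`. [folklore] -/
def TorusMaster : Prop :=
  ∀ (β : ℝ), 0 ≤ β → ∀ (L : ℕ) [NeZero L], Even L → ∀ (M : ℕ), 4 * M + 2 ≤ L →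
    ∀ (l u x y : Site 3), (∀ i, -(M : ℤ) + 1 ≤ l i) → (∀ i, u i ≤ (M : ℤ) - 1) →
      (∀ i, l i ≤ x i ∧ x i ≤ u i) → (∀ i, l i ≤ y i ∧ y i ≤ u i) →
    isingTorusTwoPoint 3 L β 0 (Torus.proj L x) (Torus.proj L y) ≤
      isingTwoPoint (zdGraph 3) (Fintype.piFinset fun i => Finset.Icc (l i) (u i)) β 0 .free x y +
        ∑ i : Fin 3, (isingTorusTwoPoint 3 L β 0 (Torus.proj L x) (Torus.reflectThroughSites i (((u i + 1 : ℤ)) : ZMod L) (Torus.proj L y)) +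
          isingTorusTwoPoint 3 L β 0 (Torus.proj L x) (Torus.reflectThroughSites i (((l i - 1 : ℤ)) : ZMod L) (Torus.proj L y)))

/-- FACE BOUND on `ℤ³` at `β_c`: `G(y−x) − ⟨σₓσ_y⟩^free_{[l,u]} ≤ ∑_{faces} G(θ_F y − x)`. [folklore] -/
def FaceBound : Prop :=
  ∀ (l u x y : Site 3), (∀ i, l i ≤ x i ∧ x i ≤ u i) → (∀ i, l i ≤ y i ∧ y i ≤ u i) → x ≠ y →
    criticalTwoPoint 3 (y - x) - isingTwoPoint (zdGraph 3) (Fintype.piFinset fun i => Finset.Icc (l i) (u i)) (criticalBeta 3) 0 .free x y ≤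
      ∑ i : Fin 3, (criticalTwoPoint 3 (Function.update y i (2 * (u i + 1) - y i) - x) +
        criticalTwoPoint 3 (Function.update y i (2 * (l i - 1) - y i) - x))

/-- AXIS FOLD CHAIN: `g(n) − freeA(n) ≤ 6 Gd(n)` for `n ≥ 1`. [folklore] -/
def AxisFoldChain : Prop :=
  ∀ n : ℕ, 1 ≤ n → criticalTwoPoint 3 (axisPt n) - freeA n ≤ 6 * criticalTwoPoint 3 (diagPt n)

/-- DIAGONAL FOLD CHAIN: `Gd(n) − freeD(n) ≤ 6 g(2n)` for `n ≥ 1`. [folklore] -/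
def DiagFoldChain : Prop :=
  ∀ n : ℕ, 1 ≤ n → criticalTwoPoint 3 (diagPt n) - freeD n ≤ 6 * criticalTwoPoint 3 (Pi.single 0 (2 * (n : ℤ)))

/-- AXIS BOX DEFICIT (open stub): `freeA(n) ≤ (1 − c) g(n)`. [folklore] -/
def AxisBoxDeficit : Prop :=
  ∃ c : ℝ, 0 < c ∧ ∀ n : ℕ, 1 ≤ n → freeA n ≤ (1 - c) * criticalTwoPoint 3 (axisPt n)

/-- DIAGONAL BOX DEFICIT (open stub): `freeD(n) ≤ (1 − c) Gd(n)`. [folklore] -/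
def DiagBoxDeficit : Prop :=
  ∃ c : ℝ, 0 < c ∧ ∀ n : ℕ, 1 ≤ n → freeD n ≤ (1 - c) * criticalTwoPoint 3 (diagPt n)

/-- CUBE FOLD CHAIN (c7, LANDED as `cubeFoldChain'`): `g(n) − freeC(n) ≤ 6 g(2n)` for `n ≥ 1`. [folklore] -/
def CubeFoldChain : Prop :=
  ∀ n : ℕ, 1 ≤ n → criticalTwoPoint 3 (axisPt n) - freeC n ≤ 6 * criticalTwoPoint 3 (Pi.single 0 (2 * (n : ℤ)))

/-- CUBE DEFICIT (c7; the line's SINGLE open stub): `freeC(n) ≤ (1 − c) g(n)`. [folklore] -/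
def CubeDeficit : Prop :=
  ∃ c : ℝ, 0 < c ∧ ∀ n : ℕ, 1 ≤ n → freeC n ≤ (1 - c) * criticalTwoPoint 3 (axisPt n)

/-! ## §2 The registered stubs -/

/-! **`stub_supermodular` LANDED: `Theorems/ReflectionTwinExistsContinuousLimitSupermodular.lean` (p162905, wave 1) — imported above. -/

/-! **`stub_confinement` LANDED: `Theorems/ReflectionTwinExistsContinuousLimitConfinement.lean` (p162852, wave 1) — imported above. -/

/-! **Stub 3 `stub_foldUnion` LANDED: `Theorems/ReflectionTwinExistsContinuousLimitFoldUnion.lean` (p162769, wave 1) — imported above. -/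

/-! **`stub_torusMaster` LANDED: `Theorems/ReflectionTwinExistsContinuousLimitTorusMaster.lean` (p163069, wave 1) — imported above. -/

/-! **`stub_faceBound` LANDED: `Theorems/ReflectionTwinExistsContinuousLimitFaceBound.lean` (p162939, wave 1) — imported above. -/

/-! **`stub_mmsFaces` LANDED: `Theorems/ReflectionTwinExistsContinuousLimitMmsFaces.lean` (p162881, lead) — imported above. -/

/-! **Stubs 7a/7b `stub_axisBoxDeficit`, `stub_diagBoxDeficit` (c5) — SUPERSEDED by the reshape c7 below (not needed by the
composition any more; their content is implied-by / same-calibre-as `stub_cubeDeficit`: `freeA ≤ freeC` by domain monotonicity). -/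

/-- **Stub 7 — THE CUBE FREE-BOX DEFICIT (open, research; the line's ONLY remaining stub).** The free-boundary two-point
function of the fat axis box `C_n = (−h, n+h) × (−n, n)²` (`h = ⌈n/2⌉`; lattice sites `1−h ≤ z₀ ≤ n+h−1`, `|z₁|, |z₂| ≤ n−1`)
at the axis pair `(0, ne₀)` is at most `(1 − c)` times the bulk critical two-point function, uniformly in `n ≥ 1`.
Exact content (nested switching lemma): `1 − freeC(n)/g(n) = P^{∅,{0,ne₀}}[0 ↮ ne₀ through edges of C_n]` for the critical
sourceless ⊗ sourced double current on `ℤ³`; numerically `c ≳ 0.5` at small `n` (free b.c. at the pair's own scale). -/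
theorem stub_cubeDeficit :
    ∃ c : ℝ, 0 < c ∧ ∀ n : ℕ, 1 ≤ n →
      isingTwoPoint (zdGraph 3)
          (Fintype.piFinset fun i : Fin 3 => Finset.Icc ((fun i : Fin 3 => if i = 0 then 1 - (((n + 1) / 2 : ℕ) : ℤ) else 1 - (n : ℤ)) i)
            ((fun i : Fin 3 => if i = 0 then (n : ℤ) + (((n + 1) / 2 : ℕ) : ℤ) - 1 else (n : ℤ) - 1) i))
          (criticalBeta 3) 0 .free 0 (Pi.single 0 (n : ℤ)) ≤
        (1 - c) * criticalTwoPoint 3 (Pi.single 0 (n : ℤ)) := by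
  sorry

/-! ## §3 Glue (proved) -/

/-- The generic confinement stub specialises to `TorusConfinement`. [folklore] -/
theorem torusConfinement_of
    (hSM : ∀ {V : Type} [DecidableEq V] (G : SimpleGraph V) [G.LocallyFinite] (Λ : Finset V) {β : ℝ}, 0 ≤ β →
      ∀ (E₁ E₂ E : Finset (Sym2 V)), E₁ ⊆ E → E₂ ⊆ E → E ⊆ edgesIn G Λ →
        currentZ G Λ β E₁ ∅ * currentZ G Λ β E₂ ∅ ≤ currentZ G Λ β (E₁ ∩ E₂) ∅ * currentZ G Λ β E ∅)
    (hC : ∀ {V : Type} [DecidableEq V] (G : SimpleGraph V) [G.LocallyFinite] (Λ : Finset V) {β : ℝ}, 0 ≤ β →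
      (∀ (E₁ E₂ E : Finset (Sym2 V)), E₁ ⊆ E → E₂ ⊆ E → E ⊆ edgesIn G Λ →
        currentZ G Λ β E₁ ∅ * currentZ G Λ β E₂ ∅ ≤ currentZ G Λ β (E₁ ∩ E₂) ∅ * currentZ G Λ β E ∅) →
      ∀ (T : Finset V), T ⊆ Λ → ∀ (x y : V), x ∈ T → y ∈ T →
        (∑' n : edgesIn G Λ → ℕ,
          ind (csources G Λ n = {x} ∆ {y} ∧ CSupp G Λ (edgesIn G Λ) n ∧ ∀ v, CConn G Λ n (edgesIn G Λ) y v → v ∈ T) *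
            cweight G Λ β n) * currentZ G Λ β (edgesIn G T) ∅ ≤
        currentZ G Λ β (edgesIn G T) ({x} ∆ {y}) * currentZ G Λ β (edgesIn G Λ) ∅) :
    TorusConfinement := by
  intro L _ β hβ T x y hx hy
  exact hC (torusGraph 3 L) univ hβ (hSM (torusGraph 3 L) univ hβ) T (subset_univ T) x y hx hy

/-- The generic fold-union stub specialises to `TorusFoldUnion`. [folklore] -/
theorem torusFoldUnion_of
    (hU : ∀ {V : Type} [DecidableEq V] (G : SimpleGraph V) [G.LocallyFinite] (Λ : Finset V) {β : ℝ}, 0 ≤ β →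
      ∀ (θ : Fin 3 × Bool → V ≃ V) (H : Fin 3 × Bool → Finset V), (∀ j, IsFoldable G (θ j) Λ (H j)) →
      ∀ (T : Finset V), (∀ j, T ⊆ H j) → (∀ v w, v ∈ T → w ∉ T → G.Adj v w → ∃ j, θ j w = w) →
      ∀ (x y : V), x ∈ T → y ∈ T →
        currentZ G Λ β (edgesIn G Λ) ({x} ∆ {y}) ≤
          (∑' n : edgesIn G Λ → ℕ,
            ind (csources G Λ n = {x} ∆ {y} ∧ CSupp G Λ (edgesIn G Λ) n ∧ ∀ v, CConn G Λ n (edgesIn G Λ) y v → v ∈ T) *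
              cweight G Λ β n) +
          ∑ j, currentZ G Λ β (edgesIn G Λ) ({x} ∆ {θ j y})) :
    TorusFoldUnion := by
  intro L _ β hβ θ H hfold T hTH hexit x y hx hy
  exact hU (torusGraph 3 L) univ hβ θ H hfold T hTH hexit x y hx hy

/-- `2·⌈n/2⌉ ≥ n`, `⌈n/2⌉ ≥ 1` for `n ≥ 1`, `2⌈n/2⌉ ≤ n + 1`. [folklore] -/
theorem hm_bounds {n : ℕ} (hn : 1 ≤ n) : n ≤ 2 * hm n ∧ 1 ≤ hm n ∧ 2 * hm n ≤ n + 1 := by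
  unfold hm; omega

/-- The axis pair lies in the axis box. [folklore] -/
theorem axis_mem {n : ℕ} (hn : 1 ≤ n) :
    (∀ i, axisLo n i ≤ (0 : Site 3) i ∧ (0 : Site 3) i ≤ axisHi n i) ∧
      (∀ i, axisLo n i ≤ axisPt n i ∧ axisPt n i ≤ axisHi n i) := by
  obtain ⟨h1, h2, h3⟩ := hm_bounds hn
  refine ⟨fun i => ?_, fun i => ?_⟩
  · fin_cases i <;> simp [axisLo, axisHi] <;> omega
  · fin_cases i <;> simp [axisLo, axisHi, axisPt] <;> omega

/-- The diagonal pair lies in the diagonal box. [folklore] -/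
theorem diag_mem {n : ℕ} (hn : 1 ≤ n) :
    (∀ i, diagLo n i ≤ (0 : Site 3) i ∧ (0 : Site 3) i ≤ diagHi n i) ∧
      (∀ i, diagLo n i ≤ diagPt n i ∧ diagPt n i ≤ diagHi n i) := by
  obtain ⟨h1, h2, h3⟩ := hm_bounds hn
  refine ⟨fun i => ?_, fun i => ?_⟩
  · fin_cases i <;> simp [diagLo, diagHi] <;> omega
  · fin_cases i <;> simp [diagLo, diagHi, diagPt] <;> omega

/-- `ne₀ ≠ 0` for `n ≥ 1`. [folklore] -/
theorem axisPt_ne_zero {n : ℕ} (hn : 1 ≤ n) : (0 : Site 3) ≠ axisPt n := by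
  intro h
  have := congrFun h 0
  simp [axisPt] at this
  omega

/-- `(n,n,0) ≠ 0` for `n ≥ 1`. [folklore] -/
theorem diagPt_ne_zero {n : ℕ} (hn : 1 ≤ n) : (0 : Site 3) ≠ diagPt n := by
  intro h
  have := congrFun h 0
  simp [diagPt] at this
  omega

/-- **Glue: face bound + MMS ⟹ the axis fold chain.** [folklore] -/
theorem axisFoldChain_of (hF : FaceBound)
    (hMMS : ∀ n : ℕ, 1 ≤ n →
      (∑ i : Fin 3, (criticalTwoPoint 3 (Function.update (Pi.single 0 (n : ℤ) : Site 3) i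
          (2 * ((fun i : Fin 3 => if i = 0 then (n : ℤ) + (((n + 1) / 2 : ℕ) : ℤ) - 1 else (((n + 1) / 2 : ℕ) : ℤ) - 1) i + 1) -
            (Pi.single 0 (n : ℤ) : Site 3) i)) +
        criticalTwoPoint 3 (Function.update (Pi.single 0 (n : ℤ) : Site 3) i
          (2 * ((fun _ : Fin 3 => 1 - (((n + 1) / 2 : ℕ) : ℤ)) i - 1) - (Pi.single 0 (n : ℤ) : Site 3) i))) ≤
      6 * criticalTwoPoint 3 (Pi.single 0 (n : ℤ) + Pi.single 1 (n : ℤ))) ∧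
    (∑ i : Fin 3, (criticalTwoPoint 3 (Function.update (Pi.single 0 (n : ℤ) + Pi.single 1 (n : ℤ) : Site 3) i
          (2 * ((fun i : Fin 3 => if i = 2 then (n : ℤ) - 1 else (n : ℤ) + (((n + 1) / 2 : ℕ) : ℤ) - 1) i + 1) -
            (Pi.single 0 (n : ℤ) + Pi.single 1 (n : ℤ) : Site 3) i)) +
        criticalTwoPoint 3 (Function.update (Pi.single 0 (n : ℤ) + Pi.single 1 (n : ℤ) : Site 3) i
          (2 * ((fun i : Fin 3 => if i = 2 then 1 - (n : ℤ) else 1 - (((n + 1) / 2 : ℕ) : ℤ)) i - 1) -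
            (Pi.single 0 (n : ℤ) + Pi.single 1 (n : ℤ) : Site 3) i))) ≤
      6 * criticalTwoPoint 3 (Pi.single 0 (2 * (n : ℤ))))) :
    AxisFoldChain ∧ DiagFoldChain := by
  refine ⟨fun n hn => ?_, fun n hn => ?_⟩
  · have h := hF (axisLo n) (axisHi n) 0 (axisPt n) (axis_mem hn).1 (axis_mem hn).2 (axisPt_ne_zero hn)
    simp only [sub_zero] at h
    -- the MMS bound, read in the folded vocabulary (definitional unfolding of `axisLo/axisHi/axisPt/hm`)
    have h' : (∑ i : Fin 3, (criticalTwoPoint 3 (Function.update (axisPt n) i (2 * (axisHi n i + 1) - axisPt n i)) +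
        criticalTwoPoint 3 (Function.update (axisPt n) i (2 * (axisLo n i - 1) - axisPt n i)))) ≤
        6 * criticalTwoPoint 3 (diagPt n) := (hMMS n hn).1
    have h'' : criticalTwoPoint 3 (axisPt n) -
        isingTwoPoint (zdGraph 3) (Fintype.piFinset fun i => Finset.Icc (axisLo n i) (axisHi n i)) (criticalBeta 3) 0 .free 0
          (axisPt n) ≤
        ∑ i : Fin 3, (criticalTwoPoint 3 (Function.update (axisPt n) i (2 * (axisHi n i + 1) - axisPt n i)) +
          criticalTwoPoint 3 (Function.update (axisPt n) i (2 * (axisLo n i - 1) - axisPt n i))) := h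
    show criticalTwoPoint 3 (axisPt n) -
        isingTwoPoint (zdGraph 3) (Fintype.piFinset fun i => Finset.Icc (axisLo n i) (axisHi n i)) (criticalBeta 3) 0 .free 0
          (axisPt n) ≤ 6 * criticalTwoPoint 3 (diagPt n)
    exact h''.trans h'
  · have h := hF (diagLo n) (diagHi n) 0 (diagPt n) (diag_mem hn).1 (diag_mem hn).2 (diagPt_ne_zero hn)
    simp only [sub_zero] at h
    have h' : (∑ i : Fin 3, (criticalTwoPoint 3 (Function.update (diagPt n) i (2 * (diagHi n i + 1) - diagPt n i)) +
        criticalTwoPoint 3 (Function.update (diagPt n) i (2 * (diagLo n i - 1) - diagPt n i)))) ≤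
        6 * criticalTwoPoint 3 (Pi.single 0 (2 * (n : ℤ))) := (hMMS n hn).2
    have h'' : criticalTwoPoint 3 (diagPt n) -
        isingTwoPoint (zdGraph 3) (Fintype.piFinset fun i => Finset.Icc (diagLo n i) (diagHi n i)) (criticalBeta 3) 0 .free 0
          (diagPt n) ≤
        ∑ i : Fin 3, (criticalTwoPoint 3 (Function.update (diagPt n) i (2 * (diagHi n i + 1) - diagPt n i)) +
          criticalTwoPoint 3 (Function.update (diagPt n) i (2 * (diagLo n i - 1) - diagPt n i))) := h
    show criticalTwoPoint 3 (diagPt n) -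
        isingTwoPoint (zdGraph 3) (Fintype.piFinset fun i => Finset.Icc (diagLo n i) (diagHi n i)) (criticalBeta 3) 0 .free 0
          (diagPt n) ≤ 6 * criticalTwoPoint 3 (Pi.single 0 (2 * (n : ℤ)))
    exact h''.trans h'

/-- **Glue: the two fold chains and the two deficits give all-scale doubling with `κ = c₁c₂/36`** (item 6150 by
name). [folklore] -/
theorem twoPointDoubling_of (hA : AxisFoldChain) (hD : DiagFoldChain) (hdA : AxisBoxDeficit) (hdD : DiagBoxDeficit) :
    MirrorHoelderCompactness.TwoPointDoubling := by
  obtain ⟨c₁, hc₁, h₁⟩ := hdA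
  obtain ⟨c₂, hc₂, h₂⟩ := hdD
  refine ⟨c₁ * c₂ / 36, by positivity, fun n hn => ?_⟩
  have eA := hA n hn
  have eD := hD n hn
  have dA := h₁ n hn
  have dD := h₂ n hn
  -- `c₁ g ≤ g − freeA ≤ 6 Gd`, `c₂ Gd ≤ Gd − freeD ≤ 6 g(2n)`
  have k₁ : c₁ * criticalTwoPoint 3 (axisPt n) ≤ 6 * criticalTwoPoint 3 (diagPt n) := by linarith
  have k₂ : c₂ * criticalTwoPoint 3 (diagPt n) ≤ 6 * criticalTwoPoint 3 (Pi.single 0 (2 * (n : ℤ))) := by linarith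
  have k₃ : c₁ * c₂ * criticalTwoPoint 3 (axisPt n) ≤ 6 * (c₂ * criticalTwoPoint 3 (diagPt n)) := by
    nlinarith [k₁, hc₂.le]
  have : c₁ * c₂ / 36 * criticalTwoPoint 3 (Pi.single 0 (n : ℤ)) ≤ criticalTwoPoint 3 (Pi.single 0 (2 * (n : ℤ))) := by
    have := k₃.trans (by linarith [k₂] : 6 * (c₂ * criticalTwoPoint 3 (diagPt n)) ≤ 36 * criticalTwoPoint 3 (Pi.single 0 (2 * (n : ℤ))))
    unfold axisPt at this
    linarith
  exact this

/-- **Glue (c7): the cube fold chain and the cube deficit give all-scale doubling with `κ = c/6`** (item 6150 by name).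
[folklore] -/
theorem twoPointDoubling_of_cube (hF : CubeFoldChain) (hd : CubeDeficit) : MirrorHoelderCompactness.TwoPointDoubling := by
  obtain ⟨c, hc, h⟩ := hd
  refine ⟨c / 6, by positivity, fun n hn => ?_⟩
  have e := hF n hn
  have d := h n hn
  unfold axisPt at e d
  linarith

/-- The landed `cubeFoldChain'` IS `CubeFoldChain` (definitional unfolding of `freeC/cbox/cubeLo/cubeHi/axisPt/hm`). [folklore] -/
theorem cubeFoldChain_holds : CubeFoldChain := fun n hn => cubeFoldChain' n hn

/-- **Composition (c7): the six landed engine stubs, the single open stub `stub_cubeDeficit` and item 4659 (by name) give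
the crux.** Glue only: engine ⟹ `FaceBound` (landed as `faceBound`) ⟹ cube fold chain (`cubeFoldChain'`, MMS) ⟹ with the
cube deficit, doubling (item 6150) ⟹ with 4659, the crux (landed split p149785). [folklore] -/
theorem ExistsContinuousLimit_of (hd : CubeDeficit) (h4659 : ClusterRigidity.ClusterSetTotallyDisconnected) :
    ReflectionTwin.ExistsContinuousLimit :=
  reflectionTwin_existsContinuousLimit_of_doubling_of_totallyDisconnected
    (twoPointDoubling_of_cube cubeFoldChain_holds hd) h4659

/-- **The crux modulo the single open stub** (item 4659 by name), through the LANDED composition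
`existsContinuousLimit_of_cubeDeficit` (Theorems/ReflectionTwinExistsContinuousLimitCubeChain.lean). -/
theorem ExistsContinuousLimit_proof (h4659 : ClusterRigidity.ClusterSetTotallyDisconnected) :
    ReflectionTwin.ExistsContinuousLimit :=
  existsContinuousLimit_of_cubeDeficit stub_cubeDeficit h4659

end Summit.CriticalPhenomena.Ising3DConformalLimit.ReflectionTwinExistsContinuousLimit.FreeBox

end
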